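import Literature.NumberTheory.Automorphic.TorusDeepOrbitalIntegralStrata      -- ★ (O2) p846544 (this seat): §2 SOCKET `classOrbitalIntegral_eq_mul_of_level_frame_of_integral_eq`, §3 `apply_symm_torus_mul_eq_piece_rank` (place-generic); closure ★ FILE C `HeisenbergStrataIntegral` §1
import Literature.NumberTheory.Automorphic.HeisenbergStrataMeasureRamified        -- ★ (O2)-ram FILE 1 (p07 (g12)): `sum_mul_measureReal_rankStrata_of_ramified` (the tame-ramified Levi column)
import HarnessLib

/-!
# The canonical orbital integral of a `K`-class piece at a deep split-torus class — TAME-RAMIFIED non-split place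
(Rogawski (1990) §4.9 pp. 54–56, Prop. 4.9.1; Flicker (1998) §2)

Topic `NumberTheory/Automorphic`; namespace `Literature.NumberTheory.Automorphic.UnitaryGroup`.  KERNEL mathematics only: theorems, no definition, no named fact,
no instance, no notation, no `sorry`.  Cell `pub/hodgecm-mathlib`, road «S3-res» ∕ LEAD T11-41 «S3-ram» seeding wave (owner F0P3a-p06 (g15)), row **(O2)-ram FILE 2**
(LEAD T11-52 (2) ∕ T11-58 (2): p07 (g12) FILE 1 `HeisenbergStrataMeasureRamified`, this seat F0P3a-p04 (g17) FILE 2); the tame-ramified twin of ★ (O2) p846544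
`TorusDeepOrbitalIntegralStrata` §3 and of ★ FILE C p846460 `HeisenbergStrataIntegral` §2.  HONEST LABEL: HC_CM is proved only modulo the 2 remaining named inputs
(hLiu418 24832, h413 24833) until rung 0 closes; this file discharges no named fact and has no books consequence (Literature seeding, `--supports 24833`).

THE MATHEMATICS.  `v` a finite place of `L⁺` NON-SPLIT and TAME-RAMIFIED in the CM field `L` (`w | v`, `σ w = w`, `e(w|v) ≠ 1`, `|2|_w = 1`), `q = N𝔭_v = N𝔓_w`
(`f(w|v) = 1`).  In ★ (O2) the ONLY consumers of «`v` unramified» are the three inert strata volumes of ★ FILE B (`q⁻³·{1, q − 1, q³ − q}`); the Ad-`K₃`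
collapse, the class-function descent SOCKET `classOrbitalIntegral_eq_mul_of_level_frame_of_integral_eq` (`∫_N F dμ_N = μ_N(N ∩ K₃)·X ⟹ O = ν_G(K′)·J₃(t)·X`), the
`K₃`-membership of a deep torus element and the residual-rank instance `apply_symm_torus_mul_eq_piece_rank` bind the non-split place `w` only.  At a tame-ramified `w`
the integral skew line lies in `𝔪_w` (★ `valued_skew_apply_lt_one_of_ramified`), so the rank-`1` stratum of `N ∩ K₃` is EMPTY-UP-TO-NULL and the strata volumes are
`μ_N(S₀) = q⁻¹·μ_N(N ∩ K₃)`, `μ_N(S₁) = 0`, `μ_N(S₂) = (1 − q⁻¹)·μ_N(N ∩ K₃)` (★ FILE 1 `sum_mul_measureReal_rankStrata_of_ramified`, p07 (g12)).  Hence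
* §1 `integral_eq_of_eq_piece_rank_of_ramified`: **`∫_N F dμ_N = μ_N(N ∩ K₃) · q⁻¹ · (c₀·1 + c₁·0 + c₂·(q − 1))`** for a residual-rank piece `F` on `N`
  (★ FILE C's proof VERBATIM over the place-generic §1 of FILE C, closed by FILE 1's Levi column);
* §2 `classOrbitalIntegral_eq_mul_rankStrata_of_torus_deep_of_ramified`: **`O^{m_G}(g, ⟦γ₀⟧) = ν_G(K′) · J₃(t) · q⁻¹ · (c₀·1 + c₁·0 + c₂·(q − 1))`** — ★ (O2) §3's
  head with `(hv : IsUnramifiedIn) (h2 : IsUnit 2)` replaced by the wave's tokens `(he : e(w|v) ≠ 1) (h2w : |2|_w = 1)`, proof = ★ g3's with §1 in place of ★ FILE C.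

## References
* [Rogawski1990] J. D. Rogawski, *Automorphic Representations of Unitary Groups in Three Variables*, Ann. of Math. Stud. 123 (1990), §4.9 pp. 54–56 (Prop. 4.9.1), §4.3 (4.3.1) p. 43.
* [Flicker1998UnitaryFL] Y. Z. Flicker, *Elementary proof of the fundamental lemma for a unitary group*, Canad. J. Math. 50 (1998), §2.
* [Kottwitz1986] R. E. Kottwitz, *Base change for unit elements of Hecke algebras*, Compositio Math. 60 (1986), §3.
* [DeitmarEchterhoff2014] A. Deitmar, S. Echterhoff, *Principles of Harmonic Analysis*, 2nd ed. (2014), Thm. 1.5.3.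
-/

set_option autoImplicit false

noncomputable section

open MeasureTheory Measure Set Filter Topology NumberField IsDedekindDomain Matrix
open Literature.MeasureTheory.Group
open scoped ENNReal NNReal Matrix MatrixGroups ValuativeRel

namespace Literature.NumberTheory.Automorphic.UnitaryGroup

open Literature.NumberTheory.Rogawski1990 (IsRegularElt)
open Literature.NumberTheory.Automorphic Literature.NumberTheory.Automorphic.IntegralReduction

variable (L : Type) [Field L] [NumberField L] [IsCMField L] (v : HeightOneSpectrum (𝓞 ↥(maximalRealSubfield L)))
  (w : PlacesOver L v) (hw : IsCMField.complexConj L • w.1 = w.1)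

/-! ## §1 The integral of a residual-rank piece over `N` at a tame-ramified place -/

set_option maxHeartbeats 800000 in
open scoped Classical in
include hw in
/-- **`∫_N F dμ_N = μ_N(N ∩ K₃) · q⁻¹ · (c₀·1 + c₁·0 + c₂·(q − 1))` AT A TAME-RAMIFIED NON-SPLIT PLACE** for every Haar measure `μ_N` of `N` and every
`F : N → ℂ` with `F(n) = c(rank(red(n_w) − 1))` on `N ∩ K₃` and `F(n) = 0` off `N ∩ K₃`: `F = Σ_r c_r·1_{S_r}` (★ FILE C §1 trichotomy, place-generic), each `S_r`
Borel of finite measure (★ FILE C §1), and ★ FILE 1 `sum_mul_measureReal_rankStrata_of_ramified` (p07 (g12)) gives the Levi column.  Twin of ★ FILE C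
`integral_eq_of_eq_piece_rank` (`hunr` ↦ `he`). [cite: Rogawski1990, §4.9 p. 54] [cite: Flicker1998UnitaryFL, §2] -/
theorem integral_eq_of_eq_piece_rank_of_ramified [MeasurableSpace ↥(unipotentU (conjLocal L (IsCMField.complexConj L) v) (cmLocalForm L 3 v))] [BorelSpace ↥(unipotentU (conjLocal L (IsCMField.complexConj L) v) (cmLocalForm L 3 v))] (μN : Measure ↥(unipotentU (conjLocal L (IsCMField.complexConj L) v) (cmLocalForm L 3 v))) [μN.IsHaarMeasure]
    (he : v.asIdeal.ramificationIdx' w.1.asIdeal ≠ 1) (h2w : Valued.v (2 : w.1.adicCompletion L) = 1) (c : ℕ → ℂ)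
    (F : ↥(unipotentU (conjLocal L (IsCMField.complexConj L) v) (cmLocalForm L 3 v)) → ℂ)
    (hF : ∀ n : ↥(unipotentU (conjLocal L (IsCMField.complexConj L) v) (cmLocalForm L 3 v)), F n = if (n : ↥(unitaryGroupOfForm (conjLocal L (IsCMField.complexConj L) v) (cmLocalForm L 3 v))) ∈ cmLocalIntegralLevel L 3 (Matrix.of fun i j : Fin 3 => if i.val + j.val + 1 = 3 then (1 : L) else 0) v then
      c (redMat (((n : ↥(unitaryGroupOfForm (conjLocal L (IsCMField.complexConj L) v) (cmLocalForm L 3 v))) : GL (Fin 3) (LocalRing L v)).val.map (Pi.evalRingHom (fun w' : PlacesOver L v => w'.1.adicCompletion L) w)) - 1).rank else 0) :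
    ∫ n, F n ∂μN =
      (μN.real {n : ↥(unipotentU (conjLocal L (IsCMField.complexConj L) v) (cmLocalForm L 3 v)) | (n : ↥(unitaryGroupOfForm (conjLocal L (IsCMField.complexConj L) v) (cmLocalForm L 3 v))) ∈ cmLocalIntegralLevel L 3 (Matrix.of fun i j : Fin 3 => if i.val + j.val + 1 = 3 then (1 : L) else 0) v} : ℂ) *
        ((Ideal.absNorm v.asIdeal : ℂ)⁻¹ * (c 0 * 1 + c 1 * 0 + c 2 * ((Ideal.absNorm v.asIdeal : ℂ) - 1))) := by
  obtain ⟨hNO, hS2, hS1, hS0⟩ := measurableSet_level_and_rankStrata L v w hw h2w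
  have hfin : μN {n : ↥(unipotentU (conjLocal L (IsCMField.complexConj L) v) (cmLocalForm L 3 v)) | (n : ↥(unitaryGroupOfForm (conjLocal L (IsCMField.complexConj L) v) (cmLocalForm L 3 v))) ∈ cmLocalIntegralLevel L 3 (Matrix.of fun i j : Fin 3 => if i.val + j.val + 1 = 3 then (1 : L) else 0) v} ≠ ∞ :=
    (isCompact_setOf_mem_level L v w hw h2w).measure_lt_top.ne
  have hfin' : ∀ r : ℕ, μN {n : ↥(unipotentU (conjLocal L (IsCMField.complexConj L) v) (cmLocalForm L 3 v)) | (n : ↥(unitaryGroupOfForm (conjLocal L (IsCMField.complexConj L) v) (cmLocalForm L 3 v))) ∈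
          cmLocalIntegralLevel L 3 (Matrix.of fun i j : Fin 3 => if i.val + j.val + 1 = 3 then (1 : L) else 0) v ∧
        (redMat (((n : ↥(unitaryGroupOfForm (conjLocal L (IsCMField.complexConj L) v) (cmLocalForm L 3 v))) : GL (Fin 3) (LocalRing L v)).val.map (Pi.evalRingHom (fun w' : PlacesOver L v => w'.1.adicCompletion L) w)) - 1).rank = r} ≠ ∞ :=
    fun r => ne_top_of_le_ne_top hfin (measure_mono fun n hn => hn.1)
  -- `F = Σ_r c_r · 1_{S_r}`
  have hFsum : F =
      Set.indicator {n : ↥(unipotentU (conjLocal L (IsCMField.complexConj L) v) (cmLocalForm L 3 v)) | (n : ↥(unitaryGroupOfForm (conjLocal L (IsCMField.complexConj L) v) (cmLocalForm L 3 v))) ∈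
          cmLocalIntegralLevel L 3 (Matrix.of fun i j : Fin 3 => if i.val + j.val + 1 = 3 then (1 : L) else 0) v ∧
        (redMat (((n : ↥(unitaryGroupOfForm (conjLocal L (IsCMField.complexConj L) v) (cmLocalForm L 3 v))) : GL (Fin 3) (LocalRing L v)).val.map (Pi.evalRingHom (fun w' : PlacesOver L v => w'.1.adicCompletion L) w)) - 1).rank = 0} (fun _ => c 0) +
      Set.indicator {n : ↥(unipotentU (conjLocal L (IsCMField.complexConj L) v) (cmLocalForm L 3 v)) | (n : ↥(unitaryGroupOfForm (conjLocal L (IsCMField.complexConj L) v) (cmLocalForm L 3 v))) ∈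
          cmLocalIntegralLevel L 3 (Matrix.of fun i j : Fin 3 => if i.val + j.val + 1 = 3 then (1 : L) else 0) v ∧
        (redMat (((n : ↥(unitaryGroupOfForm (conjLocal L (IsCMField.complexConj L) v) (cmLocalForm L 3 v))) : GL (Fin 3) (LocalRing L v)).val.map (Pi.evalRingHom (fun w' : PlacesOver L v => w'.1.adicCompletion L) w)) - 1).rank = 1} (fun _ => c 1) +
      Set.indicator {n : ↥(unipotentU (conjLocal L (IsCMField.complexConj L) v) (cmLocalForm L 3 v)) | (n : ↥(unitaryGroupOfForm (conjLocal L (IsCMField.complexConj L) v) (cmLocalForm L 3 v))) ∈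
          cmLocalIntegralLevel L 3 (Matrix.of fun i j : Fin 3 => if i.val + j.val + 1 = 3 then (1 : L) else 0) v ∧
        (redMat (((n : ↥(unitaryGroupOfForm (conjLocal L (IsCMField.complexConj L) v) (cmLocalForm L 3 v))) : GL (Fin 3) (LocalRing L v)).val.map (Pi.evalRingHom (fun w' : PlacesOver L v => w'.1.adicCompletion L) w)) - 1).rank = 2} (fun _ => c 2) := by
    funext n
    rw [Pi.add_apply, Pi.add_apply, hF n]
    by_cases hn : (n : ↥(unitaryGroupOfForm (conjLocal L (IsCMField.complexConj L) v) (cmLocalForm L 3 v))) ∈ cmLocalIntegralLevel L 3 (Matrix.of fun i j : Fin 3 => if i.val + j.val + 1 = 3 then (1 : L) else 0) v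
    · rw [if_pos hn]
      rcases rank_redMat_sub_one_cases_of_mem L v w hw h2w hn with h | h | h <;>
        simp [Set.indicator, hn, h]
    · simp [Set.indicator, hn]
  have hI : ∀ r : ℕ, MeasurableSet {n : ↥(unipotentU (conjLocal L (IsCMField.complexConj L) v) (cmLocalForm L 3 v)) | (n : ↥(unitaryGroupOfForm (conjLocal L (IsCMField.complexConj L) v) (cmLocalForm L 3 v))) ∈
          cmLocalIntegralLevel L 3 (Matrix.of fun i j : Fin 3 => if i.val + j.val + 1 = 3 then (1 : L) else 0) v ∧
        (redMat (((n : ↥(unitaryGroupOfForm (conjLocal L (IsCMField.complexConj L) v) (cmLocalForm L 3 v))) : GL (Fin 3) (LocalRing L v)).val.map (Pi.evalRingHom (fun w' : PlacesOver L v => w'.1.adicCompletion L) w)) - 1).rank = r} →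
      Integrable (Set.indicator {n : ↥(unipotentU (conjLocal L (IsCMField.complexConj L) v) (cmLocalForm L 3 v)) | (n : ↥(unitaryGroupOfForm (conjLocal L (IsCMField.complexConj L) v) (cmLocalForm L 3 v))) ∈
          cmLocalIntegralLevel L 3 (Matrix.of fun i j : Fin 3 => if i.val + j.val + 1 = 3 then (1 : L) else 0) v ∧
        (redMat (((n : ↥(unitaryGroupOfForm (conjLocal L (IsCMField.complexConj L) v) (cmLocalForm L 3 v))) : GL (Fin 3) (LocalRing L v)).val.map (Pi.evalRingHom (fun w' : PlacesOver L v => w'.1.adicCompletion L) w)) - 1).rank = r} (fun _ => c r)) μN :=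
    fun r hr => (integrable_indicator_iff hr).2 (integrableOn_const (hfin' r))
  rw [hFsum, integral_add' ((hI 0 hS0).add (hI 1 hS1)) (hI 2 hS2), integral_add' (hI 0 hS0) (hI 1 hS1),
    integral_indicator_const _ hS0, integral_indicator_const _ hS1, integral_indicator_const _ hS2,
    Complex.real_smul, Complex.real_smul, Complex.real_smul]
  linear_combination sum_mul_measureReal_rankStrata_of_ramified L v w hw μN he h2w c

/-! ## §2 The residual-rank instance at a DEEP regular split-torus class, tame-ramified place -/

section Deep

variable {v}

set_option maxHeartbeats 1600000 in
-- instance-term unification on the CM local carriers (as in ★ (O2) g3 ∕ ★ FILE D)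
include hw in
/-- **THE CANONICAL ORBITAL INTEGRAL OF A DEPTH-ZERO PIECE AT A DEEP REGULAR SPLIT-TORUS CLASS OF THE INNER FORM — TAME-RAMIFIED PLACE** ((O2)-ram).
`v` non-split, TAME-RAMIFIED in `L` (`e(w|v) ≠ 1`), `|2|_w = 1`; `ψ` a level-preserving frame with its `T ∈ GL₃(𝒪_w)` reading `(ψ g)_w = T g_w T⁻¹`; `m_G` canonical;
`t = diag(d) ∈ T` REGULAR and DEEP, `ψ γ₀ = t`; `g` a depth-zero piece supported in `K′`, `Ad K′`-invariant, `= c r` on the residually-unipotent stratum of rank `r`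
(★ (O2) g3's binders VERBATIM but `hv h2` ↦ `he h2w`).  Then
**`classOrbitalIntegral m_G g ⟦γ₀⟧ = ν_G(K′) · J₃(t) · q⁻¹ · (c₀·1 + c₁·0 + c₂·(q − 1))`**, `q = N𝔭_v`
(★ SOCKET `classOrbitalIntegral_eq_mul_of_level_frame_of_integral_eq` ∘ ★ `apply_symm_torus_mul_eq_piece_rank` ∘ §1). [cite: Rogawski1990, §4.9 Prop. 4.9.1 pp. 54–56; §4.3 (4.3.1) p. 43]
[cite: Flicker1998UnitaryFL, §2] [cite: Kottwitz1986, §3] -/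
theorem classOrbitalIntegral_eq_mul_rankStrata_of_torus_deep_of_ramified (H : Matrix (Fin 3) (Fin 3) L)
    (hH : (H.map (IsCMField.complexConj L))ᵀ = H) (hHd : IsUnit H.det)
    (he : v.asIdeal.ramificationIdx' w.1.asIdeal ≠ 1) (h2w : Valued.v (2 : w.1.adicCompletion L) = 1)
    [MeasurableSpace ((cmDatum L 3 H).Local v)] [BorelSpace ((cmDatum L 3 H).Local v)]
    [∀ γ : (cmDatum L 3 H).Local v, MeasurableSpace (((cmDatum L 3 H).Local v) ⧸ Subgroup.centralizer ({γ} : Set ((cmDatum L 3 H).Local v)))]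
    [∀ γ : (cmDatum L 3 H).Local v, BorelSpace (((cmDatum L 3 H).Local v) ⧸ Subgroup.centralizer ({γ} : Set ((cmDatum L 3 H).Local v)))]
    (νG : Measure ((cmDatum L 3 H).Local v)) [νG.IsHaarMeasure] [νG.IsMulRightInvariant]
    {mG : OrbitalMeasureFamily ((cmDatum L 3 H).Local v)}
    (hmG : mG.IsCanonical (fun γ => IsRegularElt (γ.val : GL (Fin 3) (LocalRing L v))) νG)
    [MeasurableSpace ↥(unitaryGroupOfForm (conjLocal L (IsCMField.complexConj L) v) (cmLocalForm L 3 v))]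
    [BorelSpace ↥(unitaryGroupOfForm (conjLocal L (IsCMField.complexConj L) v) (cmLocalForm L 3 v))]
    (ψ : (cmDatum L 3 H).Local v ≃ₜ* ↥(unitaryGroupOfForm (conjLocal L (IsCMField.complexConj L) v) (cmLocalForm L 3 v)))
    (hψK : ∀ g : (cmDatum L 3 H).Local v, ψ g ∈ cmLocalIntegralLevel L 3 (Matrix.of fun i j : Fin 3 => if i.val + j.val + 1 = 3 then (1 : L) else 0) v ↔
      g ∈ cmLocalIntegralLevel L 3 H v)
    (hψc : ∀ g : (cmDatum L 3 H).Local v, IsConj (g.val : GL (Fin 3) (LocalRing L v))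
      ((ψ g : ↥(unitaryGroupOfForm (conjLocal L (IsCMField.complexConj L) v) (cmLocalForm L 3 v))) : GL (Fin 3) (LocalRing L v)))
    (T : GL (Fin 3) (w.1.adicCompletion L)) (hT : T ∈ glInt 3 (w.1.adicCompletion L))
    (hψT : ∀ g : (cmDatum L 3 H).Local v, localGLPiEquiv L 3 v
        (((ψ g : ↥(unitaryGroupOfForm (conjLocal L (IsCMField.complexConj L) v) (cmLocalForm L 3 v))) : GL (Fin 3) (LocalRing L v))) w =
      T * localGLPiEquiv L 3 v (g.val : GL (Fin 3) (LocalRing L v)) w * T⁻¹)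
    (t : ↥(torusU (conjLocal L (IsCMField.complexConj L) v) (cmLocalForm L 3 v))) {d : Fin 3 → (LocalRing L v)ˣ}
    (hd : glDiagonal 3 (LocalRing L v) d =
      ((t : ↥(unitaryGroupOfForm (conjLocal L (IsCMField.complexConj L) v) (cmLocalForm L 3 v))) : GL (Fin 3) (LocalRing L v)))
    (hreg : ∀ i j, i ≠ j → IsUnit ((d i : LocalRing L v) - d j))
    (ha' : IsUnit ((((d 0)⁻¹ * d 1 : (LocalRing L v)ˣ) : LocalRing L v) - 1))
    (hb' : IsUnit ((((d 0)⁻¹ * d 2 : (LocalRing L v)ˣ) : LocalRing L v) - 1))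
    (ht1 : ∀ i : Fin 3, Valued.v ((((d i : (LocalRing L v)ˣ) : LocalRing L v) w) - 1) < 1)
    {γ₀ : (cmDatum L 3 H).Local v} (hγ₀ : ψ γ₀ = (t : ↥(unitaryGroupOfForm (conjLocal L (IsCMField.complexConj L) v) (cmLocalForm L 3 v))))
    -- the depth-zero piece: HEAD v4's binders VERBATIM
    (g : ((cmDatum L 3 H).Local v) → ℂ) (hg : Literature.NumberTheory.Rogawski1990.IsLocSmooth g) (hgK : tsupport g ⊆ (cmLocalIntegralLevel L 3 H v : Set ((cmDatum L 3 H).Local v)))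
    (hginv : ∀ u ∈ cmLocalIntegralLevel L 3 H v, ∀ x, g (u * x * u⁻¹) = g x)
    (c : ℕ → ℂ)
    (hc : ∀ k ∈ cmLocalIntegralLevel L 3 H v,
      (redMat (((k.val : GL (Fin 3) (UnitaryGroup.LocalRing L v)).val.map (Pi.evalRingHom (fun w' : PlacesOver L v => w'.1.adicCompletion L) w))) - 1) ^ 3 = 0 →
      g k = c (redMat (((k.val : GL (Fin 3) (UnitaryGroup.LocalRing L v)).val.map (Pi.evalRingHom (fun w' : PlacesOver L v => w'.1.adicCompletion L) w))) - 1).rank) :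
    classOrbitalIntegral mG g (ConjClasses.mk γ₀) =
      (νG.real (cmLocalIntegralLevel L 3 H v : Set ((cmDatum L 3 H).Local v)) : ℂ) *
        (((letI : MeasurableSpace (LocalRing L v) := borel _; haveI : BorelSpace (LocalRing L v) := ⟨rfl⟩
          haveI : SecondCountableTopology (LocalRing L v) := secondCountableTopology_localRing (E := L) v
          ((distribHaarChar (LocalRing L v) ha'.unit)⁻¹ *
            (HeisRing.skewModulus (conjLocal L (IsCMField.complexConj L) v) (continuous_conjLocal L (IsCMField.complexConj L) v) hb'.unit
              (HeisRing.map_unit_torusCentralScalar_sub_one (conjLocal L (IsCMField.complexConj L) v) (cmLocalForm_eq_over L 3 v) t hd hb'))⁻¹ :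
                ℝ≥0)) : ℝ≥0) : ℂ) *
        ((Ideal.absNorm v.asIdeal : ℂ)⁻¹ * (c 0 * 1 + c 1 * 0 + c 2 * ((Ideal.absNorm v.asIdeal : ℂ) - 1))) := by
  -- a Haar measure on `N` (it cancels)
  haveI : LocallyCompactSpace ↥(unitaryGroupOfForm (conjLocal L (IsCMField.complexConj L) v) (cmLocalForm L 3 v)) :=
    locallyCompactSpace_local (IsCMField.complexConj L) 3 _ v
  haveI : LocallyCompactSpace ↥(unipotentU (conjLocal L (IsCMField.complexConj L) v) (cmLocalForm L 3 v)) :=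
    (isClosed_cmBorelTriple_N L v).isClosedEmbedding_subtypeVal.locallyCompactSpace
  obtain ⟨μN, hμN⟩ : ∃ μN : Measure ↥(unipotentU (conjLocal L (IsCMField.complexConj L) v) (cmLocalForm L 3 v)), μN.IsHaarMeasure :=
    ⟨Measure.haar, inferInstance⟩
  haveI := hμN
  -- §1 on the rank instance `F(n) = g(ψ⁻¹(t n))`
  have hInt := integral_eq_of_eq_piece_rank_of_ramified L v w hw μN he h2w c
    (fun n => g (ψ.symm ((t : ↥(unitaryGroupOfForm (conjLocal L (IsCMField.complexConj L) v) (cmLocalForm L 3 v))) *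
      (n : ↥(unitaryGroupOfForm (conjLocal L (IsCMField.complexConj L) v) (cmLocalForm L 3 v))))))
    (fun n => apply_symm_torus_mul_eq_piece_rank L w hw H ψ hψK T hT hψT t hd ht1 g hgK c hc n)
  exact classOrbitalIntegral_eq_mul_of_level_frame_of_integral_eq L H hH hHd w hw νG hmG ψ hψK hψc μN t hd hreg ha' hb' hγ₀ g
    hg.continuous.measurable hginv _ (fun _ => rfl) _ hInt

end Deep

end Literature.NumberTheory.Automorphic.UnitaryGroup

end
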